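import Mathlib
import Literature.AlgebraicGeometry.Resolution.CobordantGame
import Literature.AlgebraicGeometry.Resolution.CobordantChartOneMove
import Summits.ResolutionOfSingularities.ResolutionOfSingularities.Theorems.WeightedInvariantLocalWeightedDropOffVertexConeWin

/-!
# `WeightedInvariant.LocalWeightedDrop`: the honest 5-variable wild specimen `g₅` — MOVE ONE (§4 R2-4, first half)

Route `ResolutionOfSingularities/WeightedInvariant`, crux `LocalWeightedDrop`
(stmt-ResolutionOfSingularities-8899).  [OURS · L1 W4.3] — first half of §4 R2-4 `won_g5` of ideator res-L1-w43-idea-1's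
`Sketch-L1-idea-1.lean` (v4): card A's SATURATED first move on `g₅ = X² + uZ⁴ + u³S⁴ + S t³` (`0 = X, 1 = u, 2 = Z, 3 = S,
4 = t`), centre `V(X, Z, S, t) ⊇ u`-axis, weights `w₁ = (2, 0, 1, 1, 1)`, in the literal chart language of the crux.
Nothing here is a statement of the manuscript under review on ladder RESOLUTION; AI-produced, weaker than expert review.

KEY OBSERVATION: `g₅` is `w₁`-WEIGHTED-HOMOGENEOUS of degree `4`, so the singular-successor criterion of the tree
(`CobordantChart.successor_singular_iff` + `initEval_coe`) reduces the successor analysis to the affine cone of `g₅` over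
the points supported on `{X, Z, S, t}`: `∂_u g₅ = Z⁴`, `∂_S g₅ = t³ (+ 4u³S³)`, `g₅ = X² + S t³ (+ …)` force
`c = (0, –, 0, γ, 0)`; every field, no characteristic hypothesis.

* `g5_chart_axisS` — at `c = (0, –, 0, γ, 0)` the chart transform is `s⁴ · G_γ` with
  `G_γ = X² + uZ⁴ + u³(γ + S)⁴ + (γ + S)t³ ∈ k⟦s, X, u, Z, S, t⟧` (variables `0..5`).
* `g5_isSuccessor_classification` — EVERY singular `s`-saturated successor of the move `(X, w₁)` is `G_γ` for some
  `γ ≠ 0` («unique singular successor, the tame point `(0:·:0:1:0)`» of the sketch, up to the torus).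
The second move (a characteristic-2 coordinate change making `G_γ` weighted-homogeneous with smooth cone) is the companion
module `…G5Won`.
-/

set_option linter.dupNamespace false -- mandated namespace of this single-conjunct summit
set_option autoImplicit false

namespace Summit.ResolutionOfSingularities.ResolutionOfSingularities.Theorems

namespace GradedGame

open MvPowerSeries
open Literature.AlgebraicGeometry.Resolution
open Literature.AlgebraicGeometry.Resolution.CobordantChart

variable {k : Type} [Field k]

/-- The chart transform of `g₅` at an `S`-axis point `c = (0, –, 0, γ, 0)` of the move `(X, (2,0,1,1,1))`:
`g₅(s²X, u, sZ, s(γ+S), st) = s⁴ · G_γ`. [OURS · L1 W4.3] -/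
theorem g5_chart_axisS (γ : k) :
    subst (chart ![2, 0, 1, 1, 1] ![(0 : k), 0, 0, γ, 0])
        (X 0 ^ 2 + X 1 * X 2 ^ 4 + X 1 ^ 3 * X 3 ^ 4 + X 3 * X 4 ^ 3 : MvPowerSeries (Fin 5) k)
      = X (0 : Fin (5 + 1)) ^ 4 *
        (X 1 ^ 2 + X 2 * X 3 ^ 4 + X 2 ^ 3 * (C γ + X 4) ^ 4 + (C γ + X 4) * X 5 ^ 3) := by
  have hc : ∀ i, (![2, 0, 1, 1, 1] : Fin 5 → ℕ) i = 0 → (![(0 : k), 0, 0, γ, 0] : Fin 5 → k) i = 0 := by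
    intro i hi; fin_cases i <;> simp_all
  have hch := hasSubst_chart (![2, 0, 1, 1, 1]) (![(0 : k), 0, 0, γ, 0]) hc
  have h0 : chart ![2, 0, 1, 1, 1] ![(0 : k), 0, 0, γ, 0] 0 = X 0 ^ 2 * X 1 := by rw [chart_apply]; simp
  have h1 : chart ![2, 0, 1, 1, 1] ![(0 : k), 0, 0, γ, 0] 1 = X 2 := by rw [chart_apply]; simp
  have h2 : chart ![2, 0, 1, 1, 1] ![(0 : k), 0, 0, γ, 0] 2 = X 0 * X 3 := by rw [chart_apply]; simp
  have h3 : chart ![2, 0, 1, 1, 1] ![(0 : k), 0, 0, γ, 0] 3 = X 0 * (C γ + X 4) := by rw [chart_apply]; simp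
  have h4 : chart ![2, 0, 1, 1, 1] ![(0 : k), 0, 0, γ, 0] 4 = X 0 * X 5 := by rw [chart_apply]; simp
  simp only [← coe_substAlgHom hch, map_add, map_mul, map_pow, substAlgHom_X]
  rw [h0, h1, h2, h3, h4]
  ring

/-- `G_γ` is not divisible by `s` (its `X²`-coefficient is `1`). [OURS · L1 W4.3] -/
theorem not_X_dvd_g5Successor (γ : k) :
    ¬ (X (0 : Fin 6) ∣ (X 1 ^ 2 + X 2 * X 3 ^ 4 + X 2 ^ 3 * (C γ + X 4) ^ 4 + (C γ + X 4) * X 5 ^ 3 :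
      MvPowerSeries (Fin 6) k)) := by
  classical
  intro h
  have := X_dvd_iff.mp h (Finsupp.single 1 2) (by simp)
  rw [map_add, map_add, map_add, coeff_X_pow, if_pos rfl,
    X_dvd_iff.mp ((dvd_pow_self (X 3 : MvPowerSeries (Fin 6) k) (by norm_num)).mul_left _) _ (by simp),
    X_dvd_iff.mp ((dvd_pow_self (X 2 : MvPowerSeries (Fin 6) k) (by norm_num)).mul_right _) _ (by simp),
    X_dvd_iff.mp ((dvd_pow_self (X 5 : MvPowerSeries (Fin 6) k) (by norm_num)).mul_left _) _ (by simp)] at this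
  simp at this

/-- MOVE ONE OF CARD A ON `g₅`: every singular `s`-saturated successor of the move `(X, (2,0,1,1,1))` (centre
`V(X,Z,S,t) ⊇ u`-axis) is `G_γ = X² + uZ⁴ + u³(γ+S)⁴ + (γ+S)t³` for some `γ ≠ 0` — the exceptional points with a singular
successor are exactly the `S`-axis points `(0:–:0:γ:0)`.  Every field. [OURS · L1 W4.3, Sketch-L1-idea-1 v4 §4 R2-4, first
move] -/
theorem g5_isSuccessor_classification (g : MvPowerSeries (Fin 6) k)
    (hg : CobordantGame.IsSuccessor k (X 0 ^ 2 + X 1 * X 2 ^ 4 + X 1 ^ 3 * X 3 ^ 4 + X 3 * X 4 ^ 3 : MvPowerSeries (Fin 5) k)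
      MvPowerSeries.X ![2, 0, 1, 1, 1] g) :
    ∃ γ : k, γ ≠ 0 ∧ g = X 1 ^ 2 + X 2 * X 3 ^ 4 + X 2 ^ 3 * (C γ + X 4) ^ 4 + (C γ + X 4) * X 5 ^ 3 := by
  classical
  obtain ⟨c, a, hoff, hfac, hndvd, hsing⟩ := hg
  set w : Fin 5 → ℕ := ![2, 0, 1, 1, 1] with hw
  set P : MvPolynomial (Fin 5) k :=
    MvPolynomial.X 0 ^ 2 + MvPolynomial.X 1 * MvPolynomial.X 2 ^ 4 + MvPolynomial.X 1 ^ 3 * MvPolynomial.X 3 ^ 4 +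
      MvPolynomial.X 3 * MvPolynomial.X 4 ^ 3 with hPdef
  have hcoe : (P : MvPowerSeries (Fin 5) k) = X 0 ^ 2 + X 1 * X 2 ^ 4 + X 1 ^ 3 * X 3 ^ 4 + X 3 * X 4 ^ 3 := by
    simp [hPdef, MvPolynomial.coe_add, MvPolynomial.coe_mul, MvPolynomial.coe_pow, MvPolynomial.coe_X]
  -- the truncated point `c'` (the crux ignores `c_u` since `w_u = 0`)
  set c' : Fin 5 → k := fun i => if 0 < w i then c i else 0 with hc'
  have hc'0 : ∀ i, w i = 0 → c' i = 0 := fun i hi => by simp [hc', hi]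
  have hfac' : subst (chart w c') (P : MvPowerSeries (Fin 5) k) = X 0 ^ a * g := by
    rw [hcoe, ← cruxChart_eq_chart]
    have : subst (MvPowerSeries.X : Fin 5 → MvPowerSeries (Fin 5) k)
        (X 0 ^ 2 + X 1 * X 2 ^ 4 + X 1 ^ 3 * X 3 ^ 4 + X 3 * X 4 ^ 3 : MvPowerSeries (Fin 5) k) =
        X 0 ^ 2 + X 1 * X 2 ^ 4 + X 1 ^ 3 * X 3 ^ 4 + X 3 * X 4 ^ 3 := by rw [MvPowerSeries.subst_self]; rfl
    rw [← this]
    exact hfac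
  -- `P` is `w`-homogeneous of degree `4`, non-zero
  have hw0 : w 0 = 2 := rfl
  have hw1 : w 1 = 0 := rfl
  have hw2 : w 2 = 1 := rfl
  have hw3 : w 3 = 1 := rfl
  have hw4 : w 4 = 1 := rfl
  have hP : P.IsWeightedHomogeneous w 4 := by
    have h0 := MvPolynomial.isWeightedHomogeneous_X (R := k) w 0
    have h1 := MvPolynomial.isWeightedHomogeneous_X (R := k) w 1
    have h2 := MvPolynomial.isWeightedHomogeneous_X (R := k) w 2
    have h3 := MvPolynomial.isWeightedHomogeneous_X (R := k) w 3
    have h4 := MvPolynomial.isWeightedHomogeneous_X (R := k) w 4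
    rw [hw0] at h0; rw [hw1] at h1; rw [hw2] at h2; rw [hw3] at h3; rw [hw4] at h4
    have hA : (MvPolynomial.X 0 ^ 2 : MvPolynomial (Fin 5) k).IsWeightedHomogeneous w (2 • 2) := h0.pow 2
    have hB : (MvPolynomial.X 1 * MvPolynomial.X 2 ^ 4 : MvPolynomial (Fin 5) k).IsWeightedHomogeneous w (0 + 4 • 1) :=
      h1.mul (h2.pow 4)
    have hC : (MvPolynomial.X 1 ^ 3 * MvPolynomial.X 3 ^ 4 : MvPolynomial (Fin 5) k).IsWeightedHomogeneous w
        (3 • 0 + 4 • 1) := (h1.pow 3).mul (h3.pow 4)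
    have hD : (MvPolynomial.X 3 * MvPolynomial.X 4 ^ 3 : MvPolynomial (Fin 5) k).IsWeightedHomogeneous w (1 + 3 • 1) :=
      h3.mul (h4.pow 3)
    have e1 : (2 • 2 : ℕ) = 4 := rfl
    have e2 : (0 + 4 • 1 : ℕ) = 4 := rfl
    have e3 : (3 • 0 + 4 • 1 : ℕ) = 4 := rfl
    have e4 : (1 + 3 • 1 : ℕ) = 4 := rfl
    rw [e1] at hA; rw [e2] at hB; rw [e3] at hC; rw [e4] at hD
    rw [hPdef]
    exact ((hA.add hB).add hC).add hD
  have hP0 : P ≠ 0 := by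
    intro h0
    have := congrArg (fun Q : MvPolynomial (Fin 5) k => (Q : MvPowerSeries (Fin 5) k)) h0
    simp only [hcoe, MvPolynomial.coe_zero] at this
    have h2 := congrArg (coeff (Finsupp.single (0 : Fin 5) 2)) this
    rw [map_add, map_add, map_add, coeff_X_pow, if_pos rfl,
      X_dvd_iff.mp ((dvd_pow_self (X 2 : MvPowerSeries (Fin 5) k) (by norm_num)).mul_left _) _ (by simp),
      X_dvd_iff.mp ((dvd_pow_self (X 3 : MvPowerSeries (Fin 5) k) (by norm_num)).mul_left _) _ (by simp),
      X_dvd_iff.mp ((dvd_pow_self (X 4 : MvPowerSeries (Fin 5) k) (by norm_num)).mul_left _) _ (by simp),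
      map_zero] at h2
    simp at h2
  have hP0' : (P : MvPowerSeries (Fin 5) k) ≠ 0 := fun h => hP0 (MvPolynomial.coe_eq_zero_iff.mp h)
  -- the exponent is the weighted order `4`
  have ha : a = 4 := by
    have h1 := eq_weightedOrder_of_factor w c' hc'0 hP0' hfac' hndvd
    rw [weightedOrder_coe_of_isWeightedHomogeneous w hP hP0] at h1
    exact_mod_cast h1
  subst ha
  -- the cone equations at `c'`
  obtain ⟨hPa, hD, -⟩ := (successor_singular_iff w c' hc'0 _ hfac').mp hsing
  rw [initEval_coe, hP.weightedHomogeneousComponent_same] at hPa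
  have hD' : ∀ i, MvPolynomial.eval c' (MvPolynomial.pderiv i P) = 0 := by
    intro i
    have := hD i
    rwa [initEvalD_coe, hP.weightedHomogeneousComponent_same] at this
  have hc1 : c' 1 = 0 := hc'0 1 hw1
  have hc2 : c' 2 = 0 := by
    have := hD' 1
    rw [hPdef] at this
    simp only [map_add, map_mul, map_pow, Derivation.leibniz, Derivation.leibniz_pow, MvPolynomial.pderiv_X,
      MvPolynomial.eval_X, smul_eq_mul] at this
    simpa [hc1] using this
  have hc4 : c' 4 = 0 := by
    have := hD' 3
    rw [hPdef] at this
    simp only [map_add, map_mul, map_pow, Derivation.leibniz, Derivation.leibniz_pow, MvPolynomial.pderiv_X,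
      MvPolynomial.eval_X, smul_eq_mul] at this
    simpa [hc1] using this
  have hc0 : c' 0 = 0 := by
    rw [hPdef] at hPa
    simp only [map_add, map_mul, map_pow, MvPolynomial.eval_X] at hPa
    simpa [hc1, hc4] using hPa
  -- so `c'` is the `S`-axis point `(0, 0, 0, γ, 0)`, `γ = c 3 ≠ 0`
  set γ : k := c 3 with hγ
  have hc3 : c' 3 = γ := by
    simp only [hc', hγ]
    rw [if_pos (by rw [hw3]; exact Nat.one_pos)]
  have hcvec : c' = ![(0 : k), 0, 0, γ, 0] := by
    funext i
    fin_cases i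
    · simpa using hc0
    · simpa using hc1
    · simpa using hc2
    · simpa using hc3
    · simpa using hc4
  have hγ0 : γ ≠ 0 := by
    obtain ⟨i, hi, hci⟩ := hoff
    have hci' : c' i ≠ 0 := by simp only [hc']; rw [if_pos hi]; exact hci
    fin_cases i
    · exact absurd hc0 hci'
    · exact absurd hc1 hci'
    · exact absurd hc2 hci'
    · rw [← hc3]; exact hci'
    · exact absurd hc4 hci'
  refine ⟨γ, hγ0, ?_⟩
  -- cancel `s⁴`
  rw [hcvec, hcoe, g5_chart_axisS] at hfac'
  exact (mul_left_cancel₀ (pow_ne_zero 4 (nonZeroDivisors.ne_zero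
    (X_mem_nonzeroDivisors (i := (0 : Fin (5 + 1))) (R := k)))) hfac').symm

end GradedGame

end Summit.ResolutionOfSingularities.ResolutionOfSingularities.Theorems
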